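import Mathlib
import HarnessLib
import Literature.Algebra.Polynomial.ChebyshevExplicitForms
import Literature.Algebra.Polynomial.ChebyshevPowerExpansion
import Literature.AlgebraicGeometry.Villaflor2022.RationalPeriodRatios

/-!
# The Chebyshev polynomial of an ellipse with foci `±1`: Rivlin, Ex. 2.4.8, 2.4.11, 2.4.12

Source: T. J. Rivlin, *The Chebyshev Polynomials*, Wiley 1974 (held scan
`book:rivlinnd-chebyshev-polynomials`, bib key `Rivlin1974`), Sect. 2.4, Exercises 2.4.8, 2.4.11 and
2.4.12 (pp. 48–49 of the scan), with Ex. 1.1.1 (`T_k(z) = (w^k + w^{-k})/2` for `z = (w + w⁻¹)/2`,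
recalled in the hint of Ex. 2.4.11).

The text. Ex. 2.4.8: let `C_ρ` be the ellipse `z = (w + 1/w)/2`, `|w| = ρ` (`0 < ρ ≤ 1`), (2.21),
with foci `(±1, 0)`; let `w_j = ρ e^{jπi/k}` and `z_j = (w_j + w_j⁻¹)/2`, `j = 0, …, 2k-1`, the
corresponding points of `C_ρ`; then `Σ(z_j) = (-1)^j` is an extremal signature for `𝒫_{k-1}`
(hint: the associated weights are `(-1)^j`). Ex. 2.4.11: `T_k(z; C_ρ) = T̃_k(z)` (`0 < ρ ≤ 1`),
where `T_k(z; B)` is the monic polynomial of degree `k` of minimum maximum modulus on `B` and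
`T̃_k = 2^{1-k} T_k`. Ex. 2.4.12: `max_{z ∈ C_ρ} |T_k(z; C_ρ)| = (ρ^k + ρ^{-k})/2^k`.

What is here (`k ≥ 1`; `ζ` any primitive `2k`-th root of unity, over `ℂ` e.g. `e^{iπ/k}`, Mathlib's
`Complex.isPrimitiveRoot_exp (2k)`; `ζ^k = -1` is the tree's
`Villaflor2022.pow_eq_neg_one_of_isPrimitiveRoot_two_mul`; the points are written out as
`(ρ ζ^j + (ρ ζ^j)⁻¹)/2`).
* `two_mul_T_eval_joukowski`: `2 T_n((w + w⁻¹)/2) = w^n + w^{-n}` (from the tree's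
  `ChebyshevExplicitForms.two_mul_chebyshevT_eval_eq_add_pow_add_sub_pow`), also for an integer
  index.
* The weights of Ex. 2.4.8: the alternating Chebyshev moments
  `Σ_{j<2k} (-1)^j 2T_n(z_j) = 2k(ρ^k + ρ^{-k}) [n = k]` for `0 ≤ n ≤ k`
  (`sum_neg_one_pow_mul_two_mul_T_eval_ellipsePoint`, integer index `|e| ≤ k` likewise), the
  monomial moments `Σ_{j<2k} (-1)^j (2z_j)^m = 2k(ρ^k + ρ^{-k}) [m = k]` for `m ≤ k` (via the
  tree's `ChebyshevPowerExpansion.two_mul_X_pow_eq_sum_T`), hence for `deg p ≤ k`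
  `Σ_{j<2k} (-1)^j p(z_j) = 2k (ρ^k + ρ^{-k}) 2^{-k} a_k` (`sum_neg_one_pow_mul_eval_ellipsePoint`):
  `= 0` on `𝒫_{k-1}` (Ex. 2.4.8, `sum_neg_one_pow_mul_eval_ellipsePoint_eq_zero`) and
  `= 2k(ρ^k + ρ^{-k})/2^k` for monic `p` of degree `k` (`…_monic`).
* Ex. 2.4.11 / 2.4.12, existence half: `|T_k((w + w⁻¹)/2)| ≤ (ρ^k + ρ^{-k})/2` on `C_ρ`
  (`norm_T_eval_joukowski_le`) with `2T_k(z_j) = (-1)^j (ρ^k + ρ^{-k})`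
  (`two_mul_T_eval_ellipsePoint`), so `max_{C_ρ} |T̃_k| = (ρ^k + ρ^{-k})/2^k`; and every monic `p`
  of degree `k` has `|p(z_j)| ≥ (ρ^k + ρ^{-k})/2^k` at some `z_j ∈ C_ρ`
  (`exists_le_norm_eval_ellipsePoint_monic`, `exists_norm_eq_and_le_norm_eval_joukowski_monic`),
  for every `ρ > 0`.

NOT typed: the notion of extremal signature (Sect. 2.3) itself, the uniqueness half of Ex. 2.4.11,
Ex. 2.4.9 (`ρ = 1`), Ex. 2.4.13–2.4.14.

Honest framing: shared numerical engines serving client cells; rigour lives in the verifiers; every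
published number belongs to a client cell's ledger, not to the engines group.
-/

open Polynomial Polynomial.Chebyshev Finset Complex
open Literature.Algebra.Polynomial.ChebyshevExplicitForms
open Literature.Algebra.Polynomial.ChebyshevPowerExpansion
open Literature.AlgebraicGeometry

namespace Literature.Analysis.Approximation.EllipseChebyshevPolynomial

/-- Ex. 1.1.1 in Joukowski form (the hint of Ex. 2.4.11): `2 T_n((w + w⁻¹)/2) = w^n + w^{-n}` for
`w ≠ 0`. [cite: Rivlin1974, Sect. 1.1 Ex. 1.1.1; Sect. 2.4 Ex. 2.4.11 (hint)] -/
theorem two_mul_T_eval_joukowski {w : ℂ} (hw : w ≠ 0) (n : ℕ) :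
    2 * (T ℂ n).eval ((w + w⁻¹) / 2) = w ^ n + w⁻¹ ^ n := by
  have hs : ((w - w⁻¹) / 2) ^ 2 = ((w + w⁻¹) / 2) ^ 2 - 1 := by
    field_simp
    ring
  have h := two_mul_chebyshevT_eval_eq_add_pow_add_sub_pow ℂ ((w + w⁻¹) / 2) ((w - w⁻¹) / 2) hs n
  rw [h]
  congr 1 <;> ring

/-- The same with an integer index: `2 T_e((w + w⁻¹)/2) = w^{|e|} + w^{-|e|}` (`T_{-e} = T_e`).
[cite: Rivlin1974, Sect. 2.4 Ex. 2.4.11 (hint)] -/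
theorem two_mul_T_eval_joukowski_int {w : ℂ} (hw : w ≠ 0) (e : ℤ) :
    2 * (T ℂ e).eval ((w + w⁻¹) / 2) = w ^ e.natAbs + w⁻¹ ^ e.natAbs := by
  rcases Int.natAbs_eq e with h | h
  · conv_lhs => rw [h]
    exact two_mul_T_eval_joukowski hw _
  · conv_lhs => rw [h, T_neg]
    exact two_mul_T_eval_joukowski hw _

/-- Geometric sums of a `2k`-th root of unity. [folklore] -/
private theorem sum_pow_range_two_mul_eq_ite {k : ℕ} {η : ℂ} (hη : η ^ (2 * k) = 1) :
    ∑ j ∈ range (2 * k), η ^ j = if η = 1 then (2 * k : ℂ) else 0 := by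
  split_ifs with h
  · simp [h]
  · rw [geom_sum_eq h, hη, sub_self, zero_div]

variable {k : ℕ} {ζ : ℂ}

/-- For a primitive `2k`-th root of unity and `0 ≤ n < k`, `ζ^n ≠ -1`. [folklore] -/
private theorem pow_ne_neg_one_of_isPrimitiveRoot_two_mul (hζ : IsPrimitiveRoot ζ (2 * k)) {n : ℕ}
    (hn : n < k) :
    ζ ^ n ≠ -1 := by
  intro h
  rcases Nat.eq_zero_or_pos n with rfl | hn0
  · norm_num at h
  · have h2 : ζ ^ (2 * n) = 1 := by rw [mul_comm, pow_mul, h]; norm_num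
    exact hζ.pow_ne_one_of_pos_of_lt (by omega) (by omega) h2

/-- The weights of Ex. 2.4.8 against the Chebyshev basis: at the points `z_j = (w_j + w_j⁻¹)/2`,
`w_j = ρ ζ^j` (`ζ` a primitive `2k`-th root of unity, `ρ ≠ 0`),
`Σ_{j<2k} (-1)^j · 2T_n(z_j) = 2k (ρ^k + ρ^{-k})` if `n = k` and `= 0` for `0 ≤ n < k`.
[cite: Rivlin1974, Sect. 2.4 Ex. 2.4.8 (hint)] -/
theorem sum_neg_one_pow_mul_two_mul_T_eval_ellipsePoint (hk : 0 < k)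
    (hζ : IsPrimitiveRoot ζ (2 * k)) {ρ : ℂ} (hρ : ρ ≠ 0) {n : ℕ} (hn : n ≤ k) :
    ∑ j ∈ range (2 * k), (-1) ^ j * (2 * (T ℂ n).eval ((ρ * ζ ^ j + (ρ * ζ ^ j)⁻¹) / 2))
      = if n = k then 2 * k * (ρ ^ k + ρ⁻¹ ^ k) else 0 := by
  have hζ0 : ζ ≠ 0 := hζ.ne_zero (by omega)
  have hterm : ∀ j ∈ range (2 * k),
      (-1 : ℂ) ^ j * (2 * (T ℂ n).eval ((ρ * ζ ^ j + (ρ * ζ ^ j)⁻¹) / 2))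
        = ρ ^ n * (-ζ ^ n) ^ j + ρ⁻¹ ^ n * (-(ζ ^ n)⁻¹) ^ j := by
    intro j _
    have e1 : (ζ ^ n) ^ j = (ζ ^ j) ^ n := by rw [← pow_mul, ← pow_mul, mul_comm]
    rw [two_mul_T_eval_joukowski (mul_ne_zero hρ (pow_ne_zero _ hζ0)), neg_pow, neg_pow (ζ ^ n)⁻¹,
      inv_pow (ζ ^ n) j, e1, mul_inv, mul_pow, mul_pow, inv_pow (ζ ^ j) n, inv_pow ρ n]
    ring
  rw [sum_congr rfl hterm, sum_add_distrib, ← mul_sum, ← mul_sum]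
  have h1 : (-ζ ^ n) ^ (2 * k) = 1 := by
    rw [neg_pow, Even.neg_one_pow ⟨k, two_mul k⟩, one_mul, ← pow_mul, mul_comm, pow_mul,
      hζ.pow_eq_one, one_pow]
  have h2 : (-(ζ ^ n)⁻¹) ^ (2 * k) = 1 := by
    rw [neg_pow, Even.neg_one_pow ⟨k, two_mul k⟩, one_mul, inv_pow, ← pow_mul, mul_comm, pow_mul,
      hζ.pow_eq_one, one_pow, inv_one]
  rw [sum_pow_range_two_mul_eq_ite h1, sum_pow_range_two_mul_eq_ite h2]
  by_cases hnk : n = k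
  · subst hnk
    have hζk := Villaflor2022.pow_eq_neg_one_of_isPrimitiveRoot_two_mul hk hζ
    rw [if_pos (by rw [hζk]; norm_num), if_pos (by rw [hζk]; norm_num), if_pos rfl]
    ring
  · have hne := pow_ne_neg_one_of_isPrimitiveRoot_two_mul hζ (lt_of_le_of_ne hn hnk)
    rw [if_neg (fun h => hne (neg_eq_iff_eq_neg.mp h)), if_neg (fun h => hne ?_), if_neg hnk]
    · ring
    · have := neg_eq_iff_eq_neg.mp h
      rwa [inv_eq_iff_eq_inv, inv_neg, inv_one] at this

/-- Integer-index version: for `|e| ≤ k`, `Σ_{j<2k} (-1)^j · 2T_e(z_j) = 2k(ρ^k + ρ^{-k})` if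
`|e| = k`, else `0`. [cite: Rivlin1974, Sect. 2.4 Ex. 2.4.8 (hint)] -/
theorem sum_neg_one_pow_mul_two_mul_T_int_eval_ellipsePoint (hk : 0 < k)
    (hζ : IsPrimitiveRoot ζ (2 * k)) {ρ : ℂ} (hρ : ρ ≠ 0) {e : ℤ} (he : e.natAbs ≤ k) :
    ∑ j ∈ range (2 * k), (-1) ^ j * (2 * (T ℂ e).eval ((ρ * ζ ^ j + (ρ * ζ ^ j)⁻¹) / 2))
      = if e.natAbs = k then 2 * k * (ρ ^ k + ρ⁻¹ ^ k) else 0 := by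
  rcases Int.natAbs_eq e with h | h
  · rw [h, Int.natAbs_natCast]
    exact sum_neg_one_pow_mul_two_mul_T_eval_ellipsePoint hk hζ hρ (by omega)
  · rw [h, T_neg, Int.natAbs_neg, Int.natAbs_natCast]
    exact sum_neg_one_pow_mul_two_mul_T_eval_ellipsePoint hk hζ hρ (by omega)

/-- The weights of Ex. 2.4.8 against the monomials: for `0 ≤ m ≤ k`,
`Σ_{j<2k} (-1)^j (2 z_j)^m = 2k(ρ^k + ρ^{-k})` if `m = k`, else `0` (via
`(2z)^m = Σ_l C(m,l) T_{m-2l}(z)`). [cite: Rivlin1974, Sect. 2.4 Ex. 2.4.8 (hint)] -/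
theorem sum_neg_one_pow_mul_two_mul_ellipsePoint_pow (hk : 0 < k) (hζ : IsPrimitiveRoot ζ (2 * k))
    {ρ : ℂ} (hρ : ρ ≠ 0) {m : ℕ} (hm : m ≤ k) :
    ∑ j ∈ range (2 * k), (-1) ^ j * (2 * ((ρ * ζ ^ j + (ρ * ζ ^ j)⁻¹) / 2)) ^ m
      = if m = k then 2 * k * (ρ ^ k + ρ⁻¹ ^ k) else 0 := by
  have hexp : ∀ z : ℂ, (2 * z) ^ m
      = ∑ l ∈ range (m + 1), ((m.choose l : ℕ) : ℂ) * (T ℂ ((m : ℤ) - 2 * l)).eval z := by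
    intro z
    have := congr_arg (Polynomial.eval z) (two_mul_X_pow_eq_sum_T (R := ℂ) m)
    simpa [eval_finsetSum] using this
  simp_rw [hexp, mul_sum]
  rw [sum_comm]
  have hl : ∀ l ∈ range (m + 1),
      ∑ j ∈ range (2 * k), (-1 : ℂ) ^ j
          * (((m.choose l : ℕ) : ℂ)
            * (T ℂ ((m : ℤ) - 2 * l)).eval ((ρ * ζ ^ j + (ρ * ζ ^ j)⁻¹) / 2))
        = ((m.choose l : ℕ) : ℂ) / 2
          * if ((m : ℤ) - 2 * l).natAbs = k then 2 * k * (ρ ^ k + ρ⁻¹ ^ k) else 0 := by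
    intro l hl
    have hl' := mem_range.mp hl
    rw [← sum_neg_one_pow_mul_two_mul_T_int_eval_ellipsePoint hk hζ hρ (e := (m : ℤ) - 2 * l)
      (by omega), mul_sum]
    exact sum_congr rfl fun j _ => by ring
  rw [sum_congr rfl hl]
  by_cases hmk : m = k
  · subst hmk
    rw [if_pos rfl]
    have hm0 : m ≠ 0 := hk.ne'
    rw [sum_eq_add_of_mem (0 : ℕ) m (by simp) (self_mem_range_succ m) hm0.symm (fun l hl hne => by
      rw [if_neg (by have := mem_range.mp hl; omega), mul_zero])]
    rw [if_pos (by simp), if_pos (by omega)]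
    simp
    ring
  · rw [if_neg hmk]
    refine sum_eq_zero fun l hl => ?_
    rw [if_neg (by have := mem_range.mp hl; omega), mul_zero]

/-- Ex. 2.4.8, the mechanism: for `deg p ≤ k` (`k ≥ 1`), the weights `(-1)^j` at the `2k` points
`z_j = (w_j + w_j⁻¹)/2`, `w_j = ρ ζ^j`, give
`Σ_{j<2k} (-1)^j p(z_j) = 2k (ρ^k + ρ^{-k}) 2^{-k} a_k`, `a_k` the coefficient of `X^k`.
[cite: Rivlin1974, Sect. 2.4 Ex. 2.4.8, Ex. 2.4.11] -/
theorem sum_neg_one_pow_mul_eval_ellipsePoint (hk : 0 < k) (hζ : IsPrimitiveRoot ζ (2 * k)) {ρ : ℂ}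
    (hρ : ρ ≠ 0) {p : ℂ[X]} (hp : p.natDegree ≤ k) :
    ∑ j ∈ range (2 * k), (-1) ^ j * p.eval ((ρ * ζ ^ j + (ρ * ζ ^ j)⁻¹) / 2)
      = 2 * k * (ρ ^ k + ρ⁻¹ ^ k) / 2 ^ k * p.coeff k := by
  have hev : ∀ x, p.eval x = ∑ m ∈ range (k + 1), p.coeff m * x ^ m :=
    fun x => eval_eq_sum_range' (Nat.lt_succ_of_le hp) x
  have hmom : ∀ m ≤ k, ∑ j ∈ range (2 * k), (-1 : ℂ) ^ j * ((ρ * ζ ^ j + (ρ * ζ ^ j)⁻¹) / 2) ^ m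
      = if m = k then 2 * k * (ρ ^ k + ρ⁻¹ ^ k) / 2 ^ k else 0 := by
    intro m hm
    have h := sum_neg_one_pow_mul_two_mul_ellipsePoint_pow hk hζ hρ hm
    have : ∀ j ∈ range (2 * k), (-1 : ℂ) ^ j * ((ρ * ζ ^ j + (ρ * ζ ^ j)⁻¹) / 2) ^ m
        = 1 / 2 ^ m * ((-1) ^ j * (2 * ((ρ * ζ ^ j + (ρ * ζ ^ j)⁻¹) / 2)) ^ m) := by
      intro j _
      rw [mul_pow]
      field_simp
    rw [sum_congr rfl this, ← mul_sum, h]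
    split_ifs with hmk
    · subst hmk; ring
    · simp
  simp_rw [hev, mul_sum]
  rw [sum_comm]
  have : ∀ m ∈ range (k + 1),
      ∑ j ∈ range (2 * k), (-1 : ℂ) ^ j * (p.coeff m * ((ρ * ζ ^ j + (ρ * ζ ^ j)⁻¹) / 2) ^ m)
        = p.coeff m * if m = k then 2 * k * (ρ ^ k + ρ⁻¹ ^ k) / 2 ^ k else 0 := by
    intro m hm
    rw [← hmom m (Nat.lt_succ_iff.mp (mem_range.mp hm)), mul_sum]
    exact sum_congr rfl fun j _ => by ring
  rw [sum_congr rfl this]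
  simp_rw [mul_ite, mul_zero]
  rw [sum_ite_eq' (range (k + 1)) k, if_pos (self_mem_range_succ k)]
  ring

/-- Ex. 2.4.8 (the associated weights): the weights `(-1)^j` at the points `z_j` of the ellipse
`C_ρ` annihilate `𝒫_{k-1}`: `Σ_{j<2k} (-1)^j p(z_j) = 0` for `deg p < k`.
[cite: Rivlin1974, Sect. 2.4 Ex. 2.4.8] -/
theorem sum_neg_one_pow_mul_eval_ellipsePoint_eq_zero (hk : 0 < k) (hζ : IsPrimitiveRoot ζ (2 * k))
    {ρ : ℂ} (hρ : ρ ≠ 0) {p : ℂ[X]} (hp : p.natDegree < k) :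
    ∑ j ∈ range (2 * k), (-1) ^ j * p.eval ((ρ * ζ ^ j + (ρ * ζ ^ j)⁻¹) / 2) = 0 := by
  rw [sum_neg_one_pow_mul_eval_ellipsePoint hk hζ hρ hp.le, coeff_eq_zero_of_natDegree_lt hp,
    mul_zero]

/-- For a monic `p` of degree `k ≥ 1`: `Σ_{j<2k} (-1)^j p(z_j) = 2k (ρ^k + ρ^{-k})/2^k`.
[cite: Rivlin1974, Sect. 2.4 Ex. 2.4.8, Ex. 2.4.11] -/
theorem sum_neg_one_pow_mul_eval_ellipsePoint_monic (hk : 0 < k) (hζ : IsPrimitiveRoot ζ (2 * k))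
    {ρ : ℂ} (hρ : ρ ≠ 0) {p : ℂ[X]} (hp : p.Monic) (hpk : p.natDegree = k) :
    ∑ j ∈ range (2 * k), (-1) ^ j * p.eval ((ρ * ζ ^ j + (ρ * ζ ^ j)⁻¹) / 2)
      = 2 * k * (ρ ^ k + ρ⁻¹ ^ k) / 2 ^ k := by
  rw [sum_neg_one_pow_mul_eval_ellipsePoint hk hζ hρ hpk.le, ← hpk,
    show p.coeff p.natDegree = 1 from hp, mul_one]

/-! ### Over the ellipse `C_ρ`: norms -/

/-- `|T_n((w + w⁻¹)/2)| ≤ (ρ^n + ρ^{-n})/2` for `|w| = ρ > 0`: the upper bound of Ex. 2.4.12 for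
`T̃_n = 2^{1-n} T_n` on the ellipse `C_ρ`. [cite: Rivlin1974, Sect. 2.4 Ex. 2.4.12] -/
theorem norm_T_eval_joukowski_le {w : ℂ} {ρ : ℝ} (hρ : 0 < ρ) (hw : ‖w‖ = ρ) (n : ℕ) :
    ‖(T ℂ n).eval ((w + w⁻¹) / 2)‖ ≤ (ρ ^ n + ρ⁻¹ ^ n) / 2 := by
  have hw0 : w ≠ 0 := by
    intro h; rw [h, norm_zero] at hw; exact hρ.ne' hw.symm
  have h2 := two_mul_T_eval_joukowski hw0 n
  have : (T ℂ n).eval ((w + w⁻¹) / 2) = (w ^ n + w⁻¹ ^ n) / 2 := by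
    rw [← h2]; ring
  rw [this, norm_div, RCLike.norm_ofNat]
  refine div_le_div_of_nonneg_right ((norm_add_le _ _).trans_eq ?_) zero_le_two
  rw [norm_pow, norm_pow, norm_inv, hw]

/-- At the points `z_j` the bound of Ex. 2.4.12 is attained with alternating signs:
`2 T_k(z_j) = (-1)^j (ρ^k + ρ^{-k})` (so `Σ(z_j) = (-1)^j` is the signature of `T̃_k` there).
[cite: Rivlin1974, Sect. 2.4 Ex. 2.4.8, Ex. 2.4.12] -/
theorem two_mul_T_eval_ellipsePoint (hk : 0 < k) (hζ : IsPrimitiveRoot ζ (2 * k)) {ρ : ℂ}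
    (hρ : ρ ≠ 0) (j : ℕ) :
    2 * (T ℂ k).eval ((ρ * ζ ^ j + (ρ * ζ ^ j)⁻¹) / 2) = (-1) ^ j * (ρ ^ k + ρ⁻¹ ^ k) := by
  have hζ0 : ζ ≠ 0 := hζ.ne_zero (by omega)
  have e1 : (ζ ^ j) ^ k = (-1) ^ j := by
    rw [← pow_mul, mul_comm, pow_mul, Villaflor2022.pow_eq_neg_one_of_isPrimitiveRoot_two_mul hk hζ]
  rw [two_mul_T_eval_joukowski (mul_ne_zero hρ (pow_ne_zero _ hζ0)), mul_inv, mul_pow, mul_pow,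
    inv_pow (ζ ^ j), e1, inv_pow]
  rw [show ((-1 : ℂ) ^ j)⁻¹ = (-1) ^ j by rw [← inv_pow, inv_neg, inv_one]]
  ring

/-- Ex. 2.4.11, existence half (via Ex. 2.4.8): a monic `p ∈ ℂ[X]` of degree `k ≥ 1` has
`|p(z_j)| ≥ (ρ^k + ρ^{-k})/2^k` at some point `z_j` of the ellipse `C_ρ`, `ρ > 0`
(`w_j = ρ e^{ijπ/k}`, `e^{iπ/k} = e^{2πi/(2k)}`).
[cite: Rivlin1974, Sect. 2.4 Ex. 2.4.11, Ex. 2.4.8] -/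
theorem exists_le_norm_eval_ellipsePoint_monic (hk : 0 < k) {p : ℂ[X]} (hp : p.Monic)
    (hpk : p.natDegree = k) {ρ : ℝ} (hρ : 0 < ρ) :
    ∃ j < 2 * k, (ρ ^ k + ρ⁻¹ ^ k) / 2 ^ k
      ≤ ‖p.eval (((ρ : ℂ) * Complex.exp (2 * Real.pi * I / (2 * k : ℕ)) ^ j
          + ((ρ : ℂ) * Complex.exp (2 * Real.pi * I / (2 * k : ℕ)) ^ j)⁻¹) / 2)‖ := by
  set ζ' := Complex.exp (2 * Real.pi * I / (2 * k : ℕ)) with hζ'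
  have hζ : IsPrimitiveRoot ζ' (2 * k) := Complex.isPrimitiveRoot_exp (2 * k) (by omega)
  have hρ0 : (ρ : ℂ) ≠ 0 := by exact_mod_cast hρ.ne'
  by_contra hcon
  simp only [not_exists, not_and, not_le] at hcon
  have hsum := sum_neg_one_pow_mul_eval_ellipsePoint_monic hk hζ hρ0 hp hpk
  have hlt : ‖∑ j ∈ range (2 * k), (-1 : ℂ) ^ j
      * p.eval (((ρ : ℂ) * ζ' ^ j + ((ρ : ℂ) * ζ' ^ j)⁻¹) / 2)‖
        < 2 * k * ((ρ ^ k + ρ⁻¹ ^ k) / 2 ^ k) := by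
    calc ‖∑ j ∈ range (2 * k), (-1 : ℂ) ^ j
          * p.eval (((ρ : ℂ) * ζ' ^ j + ((ρ : ℂ) * ζ' ^ j)⁻¹) / 2)‖
        ≤ ∑ j ∈ range (2 * k), ‖(-1 : ℂ) ^ j
            * p.eval (((ρ : ℂ) * ζ' ^ j + ((ρ : ℂ) * ζ' ^ j)⁻¹) / 2)‖ := norm_sum_le _ _
      _ < ∑ j ∈ range (2 * k), (ρ ^ k + ρ⁻¹ ^ k) / 2 ^ k := by
          refine sum_lt_sum_of_nonempty ⟨0, mem_range.mpr (by omega)⟩ fun j hj => ?_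
          rw [norm_mul, norm_pow, norm_neg, norm_one, one_pow, one_mul]
          exact hcon j (mem_range.mp hj)
      _ = 2 * k * ((ρ ^ k + ρ⁻¹ ^ k) / 2 ^ k) := by rw [sum_const, card_range]; simp
  rw [hsum] at hlt
  have : ‖(2 * k * ((ρ : ℂ) ^ k + (ρ : ℂ)⁻¹ ^ k) / 2 ^ k : ℂ)‖
      = 2 * k * ((ρ ^ k + ρ⁻¹ ^ k) / 2 ^ k) := by
    have hr : (2 * k * ((ρ : ℂ) ^ k + (ρ : ℂ)⁻¹ ^ k) / 2 ^ k : ℂ)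
        = ((2 * k * (ρ ^ k + ρ⁻¹ ^ k) / 2 ^ k : ℝ) : ℂ) := by push_cast; ring
    rw [hr, Complex.norm_real, Real.norm_of_nonneg (by positivity)]
    ring
  rw [this] at hlt
  exact lt_irrefl _ hlt

/-- Ex. 2.4.11 / Ex. 2.4.12, existence half: every monic `p ∈ ℂ[X]` of degree `k ≥ 1` has
`max_{C_ρ} |p| ≥ (ρ^k + ρ^{-k})/2^k`, the maximum modulus of `T̃_k = 2^{1-k} T_k` on `C_ρ`
(`norm_T_eval_joukowski_le`, `two_mul_T_eval_ellipsePoint`): `T̃_k` is a Chebyshev polynomial of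
`C_ρ`, for every `ρ > 0`. [cite: Rivlin1974, Sect. 2.4 Ex. 2.4.11, Ex. 2.4.12] -/
theorem exists_norm_eq_and_le_norm_eval_joukowski_monic (hk : 0 < k) {p : ℂ[X]} (hp : p.Monic)
    (hpk : p.natDegree = k) {ρ : ℝ} (hρ : 0 < ρ) :
    ∃ w : ℂ, ‖w‖ = ρ ∧ (ρ ^ k + ρ⁻¹ ^ k) / 2 ^ k ≤ ‖p.eval ((w + w⁻¹) / 2)‖ := by
  obtain ⟨j, -, hj⟩ := exists_le_norm_eval_ellipsePoint_monic hk hp hpk hρ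
  refine ⟨_, ?_, hj⟩
  rw [norm_mul, norm_pow, (Complex.isPrimitiveRoot_exp (2 * k) (by omega)).norm'_eq_one (by omega),
    one_pow, mul_one, Complex.norm_real, Real.norm_of_nonneg hρ.le]


end Literature.Analysis.Approximation.EllipseChebyshevPolynomial
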